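import Mathlib.Analysis.SpecialFunctions.Complex.Circle
import Mathlib.Topology.Homotopy.Lifting
import Mathlib.Analysis.Complex.ReImTopology
import HarnessLib

/-!
# Brouwer's fixed point theorem in the plane and the crossing lemma

Topic: Topology / PlaneTopology (`Literature/Topology/PlaneTopology/`). The planar ("algebraic
topology") input of the Jordan curve theorem in the elementary proof of
G. Buskes, A. van Rooij, *Topological Spaces* (UTM, Springer 1997), Ch. 4 and Ch. 16
(= R. Maehara, *The Jordan curve theorem via the Brouwer fixed point theorem*, Amer. Math. Monthly
91 (1984)), all **proved** here from Mathlib's covering-space theory of `Circle.exp : ℝ → Circle`: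

* `exists_lift_eq_of_norm_eq_one`: a continuous map `g` from the closed unit disc to the unit
  circle has, on the boundary circle, a continuous argument `θ` (`g (e^{it}) = e^{iθ(t)}`) with
  `θ (2π) = θ 0` ("degree zero"; homotopy lifting along the radial contraction of the disc);
* `exists_eq_mul_of_norm_eq_one` (Buskes–van Rooij Ex. 4.C): hence for every unimodular `λ` there
  is a boundary point `u` with `g u = λ u`; in particular (Ex. 4.E(i),
  `not_retraction_sphere`) the circle is not a retract of the disc;
* `exists_fixedPoint_closedBall` (**Brouwer's fixed point theorem**, Thm. 4.20) for closed discs and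
  `exists_fixedPoint_reProdIm` for closed rectangles (via the clamp retraction);
* `closedBall_subset_image` (Ex. 4.E(ii)): a continuous self-map of a closed disc fixing the boundary
  circle pointwise is onto;
* `exists_mem_of_crossing` (Thm. 4.26, Maehara's lemma): in a rectangle `[a,b] × [c,d]`, a path
  joining the two vertical sides meets every path joining the two horizontal sides.

Design: the plane is `ℂ`; discs are `Metric.closedBall c R`, rectangles are `Icc a b ×ℂ Icc c d`
(`Set.reProdIm`); maps are plain functions `ℂ → ℂ` with `ContinuousOn`/`MapsTo` hypotheses, paths
are functions `ℝ → ℂ` continuous on `[0, 1]` (so that `Path`/`C(unitInterval, ℂ)` users can apply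
the statements to coercions).

## References
* G. Buskes, A. van Rooij, *Topological Spaces: From Distance to Neighborhood*, UTM, Springer
  (1997), Thm. 4.20, Ex. 4.C, 4.E, Thm. 4.26. doi:10.1007/978-1-4612-0665-1 [BuskesVanrooij1997]
* R. Maehara, *The Jordan curve theorem via the Brouwer fixed point theorem*, Amer. Math.
  Monthly 91 (1984) 641–643, Lemma. doi:10.1080/00029890.1984.11971517 [Maehara1984]
* A. Hatcher, *Algebraic Topology* (2002), Prop. 1.30 (homotopy lifting, as in Mathlib's
  `IsCoveringMap.liftHomotopy`).
-/

noncomputable section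

open Set Metric Topology Filter Complex
open scoped Real unitInterval

namespace Literature.Topology.PlaneTopology

/-! ### Circle-valued maps on the closed unit disc -/

/-- Points of the closed unit disc in polar form `ρ e^{it}`, `ρ ∈ [0, 1]`. [folklore] -/
theorem norm_polar_le_one (ρ : I) (t : ℝ) : ‖((ρ : ℝ) : ℂ) * cexp (t * Complex.I)‖ ≤ 1 := by
  rw [norm_mul, norm_real, norm_exp_ofReal_mul_I, mul_one, Real.norm_eq_abs,
    abs_of_nonneg ρ.2.1]
  exact ρ.2.2

/-- **Circle-valued maps on the disc have degree zero on the boundary.** If `g` is continuous on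
the closed unit disc with `‖g z‖ = 1` throughout, then `t ↦ g (e^{it})` has a continuous real
argument `θ` (a lift through `Circle.exp`) with `θ (2π) = θ 0`. Proof: lift the homotopy
`(ρ, t) ↦ g (ρ e^{it})` (constant at `ρ = 0`) through the covering map `Circle.exp : ℝ → Circle`
(Mathlib's `IsCoveringMap.liftHomotopy`); the lifts of `ρ ↦ g (ρ e^{2πi})` and `ρ ↦ g (ρ e^{0})`
coincide by uniqueness of lifts. Hatcher, *Algebraic Topology*, Prop. 1.30–1.34;
Buskes–van Rooij (1997), proof of Thm. 4.20 (4.24). [folklore] -/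
theorem exists_lift_eq_of_norm_eq_one {g : ℂ → ℂ} (hg : ContinuousOn g (closedBall 0 1))
    (hg1 : ∀ z ∈ closedBall (0 : ℂ) 1, ‖g z‖ = 1) :
    ∃ θ : ℝ → ℝ, Continuous θ ∧ (∀ t, (Circle.exp (θ t) : ℂ) = g (cexp (t * Complex.I))) ∧
      θ (2 * π) = θ 0 := by
  set P : I × ℝ → ℂ := fun q => ((q.1 : ℝ) : ℂ) * cexp (q.2 * Complex.I) with hP
  have hPc : Continuous P := by
    refine Continuous.mul ?_ ?_
    · exact continuous_ofReal.comp (continuous_subtype_val.comp continuous_fst)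
    · exact Complex.continuous_exp.comp ((continuous_ofReal.comp continuous_snd).mul continuous_const)
  have hPmem : ∀ q, P q ∈ closedBall (0 : ℂ) 1 := fun q =>
    mem_closedBall_zero_iff.2 (norm_polar_le_one q.1 q.2)
  have hgP : Continuous fun q => g (P q) := hg.comp_continuous hPc hPmem
  have hmem : ∀ q, g (P q) ∈ Submonoid.unitSphere ℂ := fun q => by
    simpa [Submonoid.unitSphere] using hg1 _ (hPmem q)
  set H : C(I × ℝ, Circle) := ⟨fun q => ⟨g (P q), hmem q⟩, Continuous.subtype_mk hgP _⟩ with hH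
  have hHval : ∀ q, ((H q : Circle) : ℂ) = g (P q) := fun q => rfl
  obtain ⟨θ₀, hθ₀⟩ := Circle.exp_surjective (H (0, 0))
  have H0 : ∀ t, H (0, t) = Circle.exp ((ContinuousMap.const ℝ θ₀) t) := by
    intro t
    rw [ContinuousMap.const_apply, hθ₀]
    ext
    simp [hHval, hP]
  have cov := Circle.isCoveringMap_exp
  set L := cov.liftHomotopy H (ContinuousMap.const ℝ θ₀) H0 with hL
  have hLlift : ∀ q, Circle.exp (L q) = H q := fun q =>
    congr_fun (cov.liftHomotopy_lifts H (ContinuousMap.const ℝ θ₀) H0) q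
  have hL0 : ∀ t, L (0, t) = θ₀ := fun t => cov.liftHomotopy_zero H (ContinuousMap.const ℝ θ₀) H0 t
  refine ⟨fun t => L (1, t), L.continuous.comp (by fun_prop), fun t => ?_, ?_⟩
  · have h1 := congrArg (fun z : Circle => (z : ℂ)) (hLlift (1, t))
    simpa [hHval, hP] using h1
  · have key := cov.eq_of_comp_eq (g₁ := fun ρ : I => L (ρ, 2 * π)) (g₂ := fun ρ : I => L (ρ, 0))
      (L.continuous.comp (by fun_prop)) (L.continuous.comp (by fun_prop)) ?_ 0 (by simp [hL0])
    · exact congr_fun key 1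
    · funext ρ
      simp only [Function.comp_apply, hLlift]
      ext
      simp only [hHval, hP]
      push_cast
      rw [Complex.exp_two_pi_mul_I, zero_mul, Complex.exp_zero]

/-- **Buskes–van Rooij Ex. 4.C.** A continuous map `g` of the closed unit disc into the unit
circle takes, for every unimodular `λ`, the value `λ u` at some point `u` of the circle. From
`exists_lift_eq_of_norm_eq_one`: the argument `θ t - t` of `g (e^{it}) e^{-it}` drops by `2π`
over `[0, 2π]`, so by the intermediate value theorem it passes an argument of `λ`.
[cite: BuskesVanrooij1997, Ex. 4.C] -/
theorem exists_eq_mul_of_norm_eq_one {g : ℂ → ℂ} (hg : ContinuousOn g (closedBall 0 1))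
    (hg1 : ∀ z ∈ closedBall (0 : ℂ) 1, ‖g z‖ = 1) {l : ℂ} (hl : ‖l‖ = 1) :
    ∃ u : ℂ, ‖u‖ = 1 ∧ g u = l * u := by
  obtain ⟨θ, hθc, hθ, hper⟩ := exists_lift_eq_of_norm_eq_one hg hg1
  -- an argument `α` of `l`
  obtain ⟨α, hα⟩ : ∃ α : ℝ, cexp (α * Complex.I) = l := by
    have hl0 : l ≠ 0 := by rintro rfl; simp at hl
    refine ⟨Complex.arg l, ?_⟩
    have := Complex.norm_mul_exp_arg_mul_I l
    rw [hl, Complex.ofReal_one, one_mul] at this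
    exact this
  set d : ℝ → ℝ := fun t => θ t - t with hd
  have hdc : Continuous d := hθc.sub continuous_id
  have hd0 : d 0 = d (2 * π) + 2 * π := by simp [hd, hper]
  -- an integer `k` with `α + 2πk ∈ [d (2π), d 0]`
  set k : ℤ := ⌈(d (2 * π) - α) / (2 * π)⌉ with hk
  have h2π : 0 < 2 * π := by positivity
  have hk1 : d (2 * π) ≤ α + k * (2 * π) := by
    have := Int.le_ceil ((d (2 * π) - α) / (2 * π))
    rw [← hk, div_le_iff₀ h2π] at this
    linarith
  have hk2 : α + k * (2 * π) ≤ d 0 := by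
    have := Int.ceil_lt_add_one ((d (2 * π) - α) / (2 * π))
    rw [← hk] at this
    have h' : (k : ℝ) * (2 * π) < ((d (2 * π) - α) / (2 * π) + 1) * (2 * π) :=
      mul_lt_mul_of_pos_right this h2π
    rw [add_mul, div_mul_cancel₀ _ h2π.ne', one_mul] at h'
    linarith
  obtain ⟨t, -, ht⟩ : α + k * (2 * π) ∈ d '' Icc 0 (2 * π) :=
    intermediate_value_Icc' h2π.le hdc.continuousOn ⟨hk1, hk2⟩
  refine ⟨cexp (t * Complex.I), norm_exp_ofReal_mul_I t, ?_⟩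
  rw [← hθ t, Circle.coe_exp, ← hα, ← Complex.exp_add]
  have : θ t = t + α + k * (2 * π) := by simp only [hd] at ht; linarith
  rw [this]
  push_cast
  exact Complex.exp_eq_exp_iff_exists_int.2 ⟨k, by ring⟩

/-- **No retraction of the disc onto the circle** (Buskes–van Rooij Ex. 4.E(i)): there is no
continuous map `g` of the closed unit disc into the unit circle with `g z = z` on the circle
(apply Ex. 4.C with `λ = -1`: `g u = -u = u` is impossible for `‖u‖ = 1`).
[cite: BuskesVanrooij1997, Ex. 4.E(i)] -/
theorem not_retraction_sphere {g : ℂ → ℂ} (hg : ContinuousOn g (closedBall 0 1))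
    (hg1 : ∀ z ∈ closedBall (0 : ℂ) 1, ‖g z‖ = 1) : ¬ ∀ z : ℂ, ‖z‖ = 1 → g z = z := by
  intro hfix
  obtain ⟨u, hu, hgu⟩ := exists_eq_mul_of_norm_eq_one hg hg1 (l := -1) (by simp)
  rw [hfix u hu, neg_one_mul, eq_neg_iff_add_eq_zero, ← two_mul, mul_eq_zero] at hgu
  rcases hgu with h | h
  · norm_num at h
  · rw [h, norm_zero] at hu; exact zero_ne_one hu

/-! ### Brouwer's fixed point theorem -/

/-- **Brouwer's fixed point theorem for the closed unit disc** (Buskes–van Rooij Thm. 4.20): a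
continuous self-map `f` of the closed unit disc of `ℂ` has a fixed point. Proof: otherwise
`g z = (z - f z)/‖z - f z‖` is a continuous circle-valued map on the disc, and by Ex. 4.C there is
`‖u‖ = 1` with `g u = -u`, i.e. `f u = (1 + ‖u - f u‖) u` of norm `> 1`, absurd.
[cite: BuskesVanrooij1997, Thm. 4.20] -/
theorem exists_fixedPoint_closedUnitBall {f : ℂ → ℂ} (hf : ContinuousOn f (closedBall 0 1))
    (hmaps : MapsTo f (closedBall 0 1) (closedBall 0 1)) : ∃ z ∈ closedBall (0 : ℂ) 1, f z = z := by
  by_contra! hne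
  set g : ℂ → ℂ := fun z => ((‖z - f z‖⁻¹ : ℝ) : ℂ) * (z - f z) with hg
  have hne' : ∀ z ∈ closedBall (0 : ℂ) 1, z - f z ≠ 0 := fun z hz => sub_ne_zero.2 (hne z hz).symm
  have hgc : ContinuousOn g (closedBall 0 1) := by
    refine ContinuousOn.mul ?_ (continuousOn_id.sub hf)
    exact continuous_ofReal.comp_continuousOn
      ((continuousOn_id.sub hf).norm.inv₀ fun z hz => norm_ne_zero_iff.2 (hne' z hz))
  have hg1 : ∀ z ∈ closedBall (0 : ℂ) 1, ‖g z‖ = 1 := by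
    intro z hz
    rw [hg, norm_mul, norm_real, norm_inv, norm_norm,
      inv_mul_cancel₀ (norm_ne_zero_iff.2 (hne' z hz))]
  obtain ⟨u, hu, hgu⟩ := exists_eq_mul_of_norm_eq_one hgc hg1 (l := -1) (by simp)
  have hu' : u ∈ closedBall (0 : ℂ) 1 := mem_closedBall_zero_iff.2 hu.le
  have hpos : 0 < ‖u - f u‖ := norm_pos_iff.2 (hne' u hu')
  -- `u - f u = -‖u - f u‖ u`, so `f u = (1 + ‖u - f u‖) u` has norm `> 1`
  have h2 : u - f u = -((‖u - f u‖ : ℝ) : ℂ) * u := by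
    have h3 := congrArg (fun w => ((‖u - f u‖ : ℝ) : ℂ) * w) hgu
    simp only [hg] at h3
    rw [← mul_assoc, ← ofReal_mul, mul_inv_cancel₀ hpos.ne', ofReal_one, one_mul] at h3
    linear_combination h3
  have hfu : f u = ((1 + ‖u - f u‖ : ℝ) : ℂ) * u := by
    push_cast
    linear_combination -h2
  have hnorm := congrArg (fun w => ‖w‖) hfu
  simp only [norm_mul, norm_real, Real.norm_eq_abs, hu, mul_one] at hnorm
  rw [abs_of_pos (by positivity)] at hnorm
  have hle : ‖f u‖ ≤ 1 := mem_closedBall_zero_iff.1 (hmaps hu')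
  linarith

/-- **Brouwer's fixed point theorem for closed discs**: a continuous self-map of a closed disc
`closedBall c R` (`0 ≤ R`) of `ℂ` has a fixed point (conjugate by the similarity `z ↦ c + R z`).
[cite: BuskesVanrooij1997, Thm. 4.20 and 4.25] -/
theorem exists_fixedPoint_closedBall {f : ℂ → ℂ} {c : ℂ} {R : ℝ} (hR : 0 ≤ R)
    (hf : ContinuousOn f (closedBall c R)) (hmaps : MapsTo f (closedBall c R) (closedBall c R)) :
    ∃ z ∈ closedBall c R, f z = z := by
  rcases hR.eq_or_lt with rfl | hR
  · refine ⟨c, mem_closedBall_self le_rfl, ?_⟩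
    have := hmaps (mem_closedBall_self le_rfl)
    simpa using this
  -- conjugate: `F w = (f (c + R w) - c) / R`
  set A : ℂ → ℂ := fun w => c + R * w with hA
  have hAmem : ∀ w ∈ closedBall (0 : ℂ) 1, A w ∈ closedBall c R := by
    intro w hw
    rw [mem_closedBall, dist_eq_norm, hA]
    simp only [add_sub_cancel_left, norm_mul, norm_real, Real.norm_eq_abs, abs_of_pos hR]
    have := mem_closedBall_zero_iff.1 hw
    nlinarith
  set F : ℂ → ℂ := fun w => (R⁻¹ : ℝ) * (f (A w) - c) with hF
  have hFc : ContinuousOn F (closedBall 0 1) := by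
    refine continuousOn_const.mul (ContinuousOn.sub ?_ continuousOn_const)
    exact hf.comp (by fun_prop) hAmem
  have hFmaps : MapsTo F (closedBall 0 1) (closedBall 0 1) := by
    intro w hw
    have h := hmaps (hAmem w hw)
    rw [mem_closedBall, dist_eq_norm] at h
    rw [mem_closedBall_zero_iff, hF]
    simp only [norm_mul, norm_real, Real.norm_eq_abs, abs_of_pos (inv_pos.2 hR)]
    rw [inv_mul_le_iff₀ hR, mul_one]
    exact h
  obtain ⟨w, hw, hFw⟩ := exists_fixedPoint_closedUnitBall hFc hFmaps
  refine ⟨A w, hAmem w hw, ?_⟩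
  have h : (R : ℂ) * F w = (R : ℂ) * w := by rw [hFw]
  simp only [hF] at h
  rw [← mul_assoc, ← ofReal_mul, mul_inv_cancel₀ hR.ne', ofReal_one, one_mul, sub_eq_iff_eq_add] at h
  rw [h, hA]; ring


/-- The coordinate box `[a, b] × [c, d] ⊆ ℂ` is bounded, hence inside some closed disc about `0`.
[folklore] -/
theorem reProdIm_Icc_subset_closedBall (a b c d : ℝ) :
    ∃ R : ℝ, 0 ≤ R ∧ Icc a b ×ℂ Icc c d ⊆ closedBall (0 : ℂ) R := by
  obtain ⟨R, hR⟩ := (isBounded_iff_subset_closedBall 0).1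
    ((isBounded_Icc a b).reProdIm (isBounded_Icc c d))
  exact ⟨max R 0, le_max_right _ _, hR.trans (closedBall_subset_closedBall (le_max_left _ _))⟩

/-- **Brouwer's fixed point theorem for closed rectangles**: a continuous self-map `f` of the box
`[a, b] × [c, d] ⊆ ℂ` has a fixed point. Proof: precompose `f` with the (continuous) clamp
retraction `z ↦ (clamp_[a,b] (re z), clamp_[c,d] (im z))` of `ℂ` onto the box and apply the disc
version on a large disc containing the box (Buskes–van Rooij 4.25 argue via a homeomorphism
square ≅ disc instead). [cite: BuskesVanrooij1997, 4.25] -/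
theorem exists_fixedPoint_reProdIm {f : ℂ → ℂ} {a b c d : ℝ} (hab : a ≤ b) (hcd : c ≤ d)
    (hf : ContinuousOn f (Icc a b ×ℂ Icc c d))
    (hmaps : MapsTo f (Icc a b ×ℂ Icc c d) (Icc a b ×ℂ Icc c d)) :
    ∃ z ∈ Icc a b ×ℂ Icc c d, f z = z := by
  obtain ⟨R, hR0, hKR⟩ := reProdIm_Icc_subset_closedBall a b c d
  -- the clamp retraction onto the box
  set P : ℂ → ℂ := fun z =>
    ((projIcc a b hab z.re : ℝ) : ℂ) + ((projIcc c d hcd z.im : ℝ) : ℂ) * Complex.I with hP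
  have hPre : ∀ z, (P z).re = max a (min b z.re) := fun z => by simp [hP, coe_projIcc]
  have hPim : ∀ z, (P z).im = max c (min d z.im) := fun z => by simp [hP, coe_projIcc]
  have hPc : Continuous P := by
    simp only [hP]
    fun_prop
  have hPmem : ∀ z, P z ∈ Icc a b ×ℂ Icc c d := fun z => by
    rw [mem_reProdIm, hPre, hPim]
    exact ⟨⟨le_max_left _ _, max_le hab (min_le_left _ _)⟩,
      ⟨le_max_left _ _, max_le hcd (min_le_left _ _)⟩⟩
  have hPid : ∀ z ∈ Icc a b ×ℂ Icc c d, P z = z := fun z hz => by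
    rw [mem_reProdIm] at hz
    apply Complex.ext
    · rw [hPre, min_eq_right hz.1.2, max_eq_right hz.1.1]
    · rw [hPim, min_eq_right hz.2.2, max_eq_right hz.2.1]
  have hc : ContinuousOn (f ∘ P) (closedBall 0 R) := (hf.comp_continuous hPc hPmem).continuousOn
  obtain ⟨z, -, hz⟩ := exists_fixedPoint_closedBall hR0 hc (fun z _ => hKR (hmaps (hPmem z)))
  have hzK : z ∈ Icc a b ×ℂ Icc c d := by
    rw [← hz]
    exact hmaps (hPmem z)
  refine ⟨z, hzK, ?_⟩
  rwa [Function.comp_apply, hPid z hzK] at hz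

/-- **Buskes–van Rooij Ex. 4.E(ii).** A continuous map `g` of a closed disc into `ℂ` which fixes
the boundary circle pointwise takes every value in the disc. Proof: if `w` (necessarily in the
open disc) were omitted, `F z = c - R (g z - w)/‖g z - w‖` would be a continuous self-map of the
disc whose fixed points `z` lie on the circle, where `g z = z` forces `z` to be a convex
combination of `c` and `w`, hence inside the open disc — contradicting Brouwer's theorem.
[cite: BuskesVanrooij1997, Ex. 4.E(ii)] -/
theorem closedBall_subset_image {g : ℂ → ℂ} {c : ℂ} {R : ℝ} (hg : ContinuousOn g (closedBall c R))
    (hfix : ∀ z : ℂ, ‖z - c‖ = R → g z = z) : closedBall c R ⊆ g '' closedBall c R := by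
  intro w hw
  by_contra hnot
  have hne : ∀ z ∈ closedBall c R, g z - w ≠ 0 := fun z hz h => hnot ⟨z, hz, sub_eq_zero.1 h⟩
  have hwR : ‖w - c‖ < R := by
    rcases (mem_closedBall_iff_norm.1 hw).lt_or_eq with h | h
    · exact h
    · exact absurd ⟨w, hw, hfix w h⟩ hnot
  have hRpos : 0 < R := (norm_nonneg _).trans_lt hwR
  set μ : ℂ → ℝ := fun z => R * ‖g z - w‖⁻¹ with hμ
  set F : ℂ → ℂ := fun z => c - ((μ z : ℝ) : ℂ) * (g z - w) with hF
  have hμc : ContinuousOn μ (closedBall c R) :=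
    continuousOn_const.mul ((hg.sub continuousOn_const).norm.inv₀ fun z hz =>
      norm_ne_zero_iff.2 (hne z hz))
  have hFc : ContinuousOn F (closedBall c R) :=
    continuousOn_const.sub ((continuous_ofReal.comp_continuousOn hμc).mul (hg.sub continuousOn_const))
  have hμpos : ∀ z ∈ closedBall c R, 0 < μ z := fun z hz =>
    mul_pos hRpos (inv_pos.2 (norm_pos_iff.2 (hne z hz)))
  have hFnorm : ∀ z ∈ closedBall c R, ‖F z - c‖ = R := by
    intro z hz
    have hn0 : ‖g z - w‖ ≠ 0 := norm_ne_zero_iff.2 (hne z hz)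
    rw [hF]
    simp only [sub_sub_cancel_left, norm_neg, norm_mul, norm_real, Real.norm_eq_abs, hμ,
      abs_of_pos hRpos, abs_inv, abs_norm]
    rw [mul_assoc, inv_mul_cancel₀ hn0, mul_one]
  have hFmaps : MapsTo F (closedBall c R) (closedBall c R) := fun z hz =>
    mem_closedBall_iff_norm.2 (hFnorm z hz).le
  obtain ⟨z, hz, hFz⟩ := exists_fixedPoint_closedBall hRpos.le hFc hFmaps
  have hzR : ‖z - c‖ = R := by rw [← hFnorm z hz, hFz]
  have hgz : g z = z := hfix z hzR
  -- `(1 + μ) (z - c) = μ (w - c)`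
  have hlin : ((1 + μ z : ℝ) : ℂ) * (z - c) = ((μ z : ℝ) : ℂ) * (w - c) := by
    have h := hFz
    simp only [hF, hgz] at h
    push_cast
    linear_combination -h
  have hn := congrArg (fun v => ‖v‖) hlin
  simp only [norm_mul, norm_real, Real.norm_eq_abs, abs_of_pos (hμpos z hz),
    abs_of_pos (add_pos one_pos (hμpos z hz)), hzR] at hn
  have : μ z * ‖w - c‖ < μ z * R := mul_lt_mul_of_pos_left hwR (hμpos z hz)
  nlinarith [hμpos z hz]

/-! ### The crossing lemma -/

/-- **The crossing lemma** (Buskes–van Rooij Thm. 4.26; Maehara (1984), Lemma): let `β` and `γ` be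
paths in the rectangle `[a, b] × [c, d]`, `β` joining the bottom side to the top side
(`im (β 0) = c`, `im (β 1) = d`) and `γ` joining the left side to the right side
(`re (γ 0) = a`, `re (γ 1) = b`). Then they meet. Proof: otherwise, with
`M (s, t) = max |re (β t) - re (γ s)| |im (γ s) - im (β t)| > 0`, the map
`(s, t) ↦ ((re (β t) - re (γ s))/M, (im (γ s) - im (β t))/M)` is a continuous self-map of the square
`[-1, 1]²` with values on its boundary, and each of the four boundary cases for a Brouwer fixed
point contradicts the side conditions. (The book parametrises paths by `[-1, 1]`; here by
`[0, 1]`, and the square is rescaled to `[0, 1]²`.)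
[cite: BuskesVanrooij1997, Thm. 4.26] [cite: Maehara1984, Lemma] -/
theorem exists_mem_of_crossing {β γ : ℝ → ℂ} {a b c d : ℝ}
    (hβ : ContinuousOn β (Icc 0 1)) (hγ : ContinuousOn γ (Icc 0 1))
    (hβK : MapsTo β (Icc 0 1) (Icc a b ×ℂ Icc c d)) (hγK : MapsTo γ (Icc 0 1) (Icc a b ×ℂ Icc c d))
    (hβ0 : (β 0).im = c) (hβ1 : (β 1).im = d) (hγ0 : (γ 0).re = a) (hγ1 : (γ 1).re = b) :
    ∃ s ∈ Icc (0 : ℝ) 1, ∃ t ∈ Icc (0 : ℝ) 1, β t = γ s := by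
  by_contra! hne
  set S : Set ℂ := Icc 0 1 ×ℂ Icc 0 1 with hS
  -- `z = s + t i` ranges over the unit square; `u, v` are the two normalised differences
  set M : ℂ → ℝ := fun z => max |(β z.im).re - (γ z.re).re| |(γ z.re).im - (β z.im).im| with hM
  have hMpos : ∀ z ∈ S, 0 < M z := by
    intro z hz
    rw [hS, mem_reProdIm] at hz
    by_contra h
    have h0 : M z = 0 := le_antisymm (not_lt.1 h) (le_max_of_le_left (abs_nonneg _))
    have h1 : |(β z.im).re - (γ z.re).re| = 0 :=
      le_antisymm (h0 ▸ le_max_left _ _) (abs_nonneg _)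
    have h2 : |(γ z.re).im - (β z.im).im| = 0 :=
      le_antisymm (h0 ▸ le_max_right _ _) (abs_nonneg _)
    rw [abs_eq_zero, sub_eq_zero] at h1 h2
    exact hne z.re hz.1 z.im hz.2 (Complex.ext h1 h2.symm)
  set u : ℂ → ℝ := fun z => ((β z.im).re - (γ z.re).re) / M z with hu
  set v : ℂ → ℝ := fun z => ((γ z.re).im - (β z.im).im) / M z with hv
  set Φ : ℂ → ℂ := fun z => (((1 + u z) / 2 : ℝ) : ℂ) + (((1 + v z) / 2 : ℝ) : ℂ) * Complex.I
    with hΦ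
  have hΦre : ∀ z, (Φ z).re = (1 + u z) / 2 := fun z => by simp [hΦ]
  have hΦim : ∀ z, (Φ z).im = (1 + v z) / 2 := fun z => by simp [hΦ]
  -- continuity on the square
  have hβc : ContinuousOn (fun z : ℂ => β z.im) S :=
    hβ.comp continuous_im.continuousOn fun z hz => (mem_reProdIm.1 hz).2
  have hγc : ContinuousOn (fun z : ℂ => γ z.re) S :=
    hγ.comp continuous_re.continuousOn fun z hz => (mem_reProdIm.1 hz).1
  have h1c : ContinuousOn (fun z : ℂ => (β z.im).re - (γ z.re).re) S :=
    (continuous_re.comp_continuousOn hβc).sub (continuous_re.comp_continuousOn hγc)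
  have h2c : ContinuousOn (fun z : ℂ => (γ z.re).im - (β z.im).im) S :=
    (continuous_im.comp_continuousOn hγc).sub (continuous_im.comp_continuousOn hβc)
  have hMc : ContinuousOn M S :=
    (continuous_abs.comp_continuousOn h1c).sup (continuous_abs.comp_continuousOn h2c)
  have huc : ContinuousOn u S := h1c.div hMc fun z hz => (hMpos z hz).ne'
  have hvc : ContinuousOn v S := h2c.div hMc fun z hz => (hMpos z hz).ne'
  have hΦc : ContinuousOn Φ S := by
    refine ContinuousOn.add ?_ (ContinuousOn.mul ?_ continuousOn_const)
    · exact continuous_ofReal.comp_continuousOn ((continuousOn_const.add huc).div_const _)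
    · exact continuous_ofReal.comp_continuousOn ((continuousOn_const.add hvc).div_const _)
  -- `|u|, |v| ≤ 1` and one of them is `= 1`
  have hule : ∀ z ∈ S, |u z| ≤ 1 := fun z hz => by
    rw [hu, abs_div, abs_of_pos (hMpos z hz), div_le_one (hMpos z hz)]
    exact le_max_left _ _
  have hvle : ∀ z ∈ S, |v z| ≤ 1 := fun z hz => by
    rw [hv, abs_div, abs_of_pos (hMpos z hz), div_le_one (hMpos z hz)]
    exact le_max_right _ _
  have huv : ∀ z ∈ S, |u z| = 1 ∨ |v z| = 1 := fun z hz => by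
    rcases max_choice |(β z.im).re - (γ z.re).re| |(γ z.re).im - (β z.im).im| with h | h
    · left
      rw [hu, abs_div, abs_of_pos (hMpos z hz), div_eq_one_iff_eq (hMpos z hz).ne']
      exact h.symm
    · right
      rw [hv, abs_div, abs_of_pos (hMpos z hz), div_eq_one_iff_eq (hMpos z hz).ne']
      exact h.symm
  have hΦmaps : MapsTo Φ S S := by
    intro z hz
    rw [hS, mem_reProdIm, hΦre, hΦim]
    have h1 := abs_le.1 (hule z hz)
    have h2 := abs_le.1 (hvle z hz)
    constructor <;> constructor <;> linarith [h1.1, h1.2, h2.1, h2.2]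
  obtain ⟨z, hz, hΦz⟩ := exists_fixedPoint_reProdIm zero_le_one zero_le_one hΦc hΦmaps
  have hzS := hz
  rw [mem_reProdIm] at hz
  have hre : z.re = (1 + u z) / 2 := by rw [← hΦre z, hΦz]
  have him : z.im = (1 + v z) / 2 := by rw [← hΦim z, hΦz]
  have hβz := mem_reProdIm.1 (hβK hz.2)
  have hγz := mem_reProdIm.1 (hγK hz.1)
  -- the sign of the numerators on the four sides
  rcases huv z hzS with h | h
  · rcases (abs_eq (zero_le_one' ℝ)).1 h with h' | h'
    · -- `u = 1`: `s = 1`, `re (γ 1) = b ≤ ... `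
      have hs : z.re = 1 := by rw [hre, h']; norm_num
      have hnum : (β z.im).re - (γ z.re).re ≤ 0 := by rw [hs, hγ1]; linarith [hβz.1.2]
      have : u z ≤ 0 := div_nonpos_of_nonpos_of_nonneg hnum (hMpos z hzS).le
      linarith
    · have hs : z.re = 0 := by rw [hre, h']; norm_num
      have hnum : 0 ≤ (β z.im).re - (γ z.re).re := by rw [hs, hγ0]; linarith [hβz.1.1]
      have : 0 ≤ u z := div_nonneg hnum (hMpos z hzS).le
      linarith
  · rcases (abs_eq (zero_le_one' ℝ)).1 h with h' | h'
    · have ht : z.im = 1 := by rw [him, h']; norm_num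
      have hnum : (γ z.re).im - (β z.im).im ≤ 0 := by rw [ht, hβ1]; linarith [hγz.2.2]
      have : v z ≤ 0 := div_nonpos_of_nonpos_of_nonneg hnum (hMpos z hzS).le
      linarith
    · have ht : z.im = 0 := by rw [him, h']; norm_num
      have hnum : 0 ≤ (γ z.re).im - (β z.im).im := by rw [ht, hβ0]; linarith [hγz.2.1]
      have : 0 ≤ v z := div_nonneg hnum (hMpos z hzS).le
      linarith

end Literature.Topology.PlaneTopology
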